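import Mathlib
import Summits.ValiantsHypothesis.ValiantsHypothesis.Theses.LacunarySymmetroid
import Summits.ValiantsHypothesis.ValiantsHypothesis.Theorems.MatrixDescartes.Negative.MatrixDescartesWitness24
import Summits.ValiantsHypothesis.ValiantsHypothesis.Theorems.LacunarySymmetroidMatrixDescartesStubDescartesCeiling
import Summits.ValiantsHypothesis.ValiantsHypothesis.Theorems.LacunarySymmetroidMatrixDescartesCensusM2K8G21
import Summits.ValiantsHypothesis.ValiantsHypothesis.Theorems.LacunarySymmetroidMatrixDescartesCensusM2K9T27
import Summits.ValiantsHypothesis.ValiantsHypothesis.Theorems.LacunarySymmetroidMatrixDescartesCensusM2K10I30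
import Literature.Computability.AlgebraicComplexity.RealTauKnownCases

/-!
# `MatrixDescartes` — line «stamp» (val-idea-6 g3, LINE 2; lens «assume the law fails»): the STAMP ANSATZ for the
# row `m = 2` — full-positive-rooted `2×2` half-pencils on EXTREMAL ADDITIVE 2-BASES, and the DIVERGENCE CELL `(2,8)`
# where Descartes/stamp-sharpness and every LINEAR row law (eleven-thirds, slope law) part ways

HONEST FRAMING.  Crux `Summit.ValiantsHypothesis.ValiantsHypothesis.Theses.LacunarySymmetroid.MatrixDescartes`
(stmt-18050) is asymptotic; nothing here bears on it or on `VP ≠ VNP`.  This is an INSTRUMENT line for the desk's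
row `m = 2` (kernel floors `ζ(2,K) ≥ 5, 9, 14, 18, 22, 21…25, 27, 30` for `K = 3 … 10`; filed laws «eleven-thirds»
`ζ_sym(2,K) ≤ ⌊11(K−1)/3⌋` and «slope» `ζ_sym(2,K) ≤ 4(K−1)`, both LINEAR in `K`), built on line «finite»'s dictionary
(`Cruxes/MatrixDescartes/Lines/finite.lean`: doubling, postage-stamp ceiling `ν(m,K) ≤ n(m,K−1)`, gap rule).

THE TENSION (new).  A full-positive-rooted half-pencil IS a census entry: `ν(m,K) ≤ ζ(m,K)` (§1, PROVED).  At `m = 2`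
the located full realisations sit EXACTLY at the postage-stamp number wherever an extremal basis was searched:
`ν(2,3) = 4 = n(2,2)` on `(0,1,3)`, `ν(2,4) = 8 = n(2,3)` on `(0,1,3,4)`, `ν(2,5) = 12 = n(2,4)` on `(0,1,3,5,6)`
(engine-5 W1, untargeted); the extremal bases for `K ≥ 6` — `(0,1,3,5,7,8)` (`n(2,5)=16`), the five `n(2,6) = 20`
bases, the three `n(2,7) = 26` bases `{1,3,5,7,8,17,18}, {1,3,4,9,10,12,13}, {1,2,5,8,11,12,13}`, the two
`n(2,8) = 32` bases `{1,3,5,7,9,10,21,22}, {1,2,5,8,11,14,15,16}` (`instr/hbasis2.py`, classical tables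
[Guy UPINT C12; Challis 1993; OEIS A001212: 2,4,8,12,16,20,26,32,40,46,54,…]) — were NEVER SEARCHED (engine-5 stops at
`K = 6`; the `K ≥ 7` records are tail-GRAFTS on clustered sparse supports, degree ≫ roots, growing `+3,+2,+2`).
Stamp-sharpness `ν(2,K) = n(2,K−1)` (crit-1's Lorentz-model bet: `det = T² − X² − Y²`, §5, a `K`-monomial curve in
`ℝ^{1,2}` crossing the light cone) is QUADRATIC (`n(2,k) ≥ k²/4 + O(k)`, Rohrbach; `lim n(2,k)/k² ∈ [2/7, 0.4802]`),
every filed row law is LINEAR — and the two curves cross at **`K = 8`: `n(2,7) = 26 > 25 = ⌊11·7/3⌋`** (then `32 > 29`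
at `K = 9`, `40 > 36 = 4·9` at `K = 10`, `46 > 36/40`, `54 > 40/44` …).  So (§4, PROVED bookkeeping):
* ONE full-positive-rooted `2×2` half-pencil of degree `26` on an extremal `A₇` REFUTES «eleven-thirds» (and is a `+1`
  register move over the located `25`; at `K = 9, 10` full realisations would be `+5`, `+10` over the kernel floors);
* conversely «eleven-thirds at `K = 8`» says the three extremal `A₇` are NOT fully realisable (`elevenThirds_blocks_A7`):
  the FIRST LOCATED NON-REALISABILITY of a postage-admissible degree by symmetric pencils — the `m = 2` toy of the
  `StampNonRealisability` that line «finite» showed H3 to BE at quasi-polynomial size («assume the law fails ⇒ the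
  violators are full-positive-rooted half-pencils on near-extremal stamp bases»; what a format law NEEDS is a
  light-cone crossing bound that beats Descartes — no such theorem is known for rank-3 quadratic forms on a Descartes
  system, §5).
Either outcome of the finite search is informative; neither touches H3's `2^{K log K}` or `VP ≠ VNP`.

COMPUTATION SECOND (typed targets §3, for eng-1's 26-hunt / engine-5 / hw1; certificate = integer symmetric `2×2`
half-pencil `(d, S)` on the listed support with `deg + 1` increasing dyadic points of alternating `det` sign, all
positive — then `not_posRootLawAt_of_certificate` (CensusKit) lands the row and §1 is not even needed):
`G6` `(2,6)`: 16 on `(0,1,3,5,7,8)` · `G7` `(2,7)`: 20 on an `n(2,6)`-basis · **`G8` `(2,8)`: 26 on an `A₇`** ·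
`G9` `(2,9)`: 32 on an `A₈` · (`G10`: 40 on an `A₉`, `n(2,9) = 40`).  Search hint (Lorentz model): parametrise
`S_l = (t_l + x_l, y_l; y_l, t_l − x_l)`, demand all `27` coefficients of `T² − X² − Y²` alternate (`[0,26] ⊆ 2A` makes
this possible ONLY on extremal/near-extremal bases), then push roots real by continuation from the located `K = 5` full
record `E5W1A-m2K5-d0-1-3-5-6-s0-n12-00`.
-/

set_option linter.dupNamespace false

noncomputable section

namespace Summit.ValiantsHypothesis.ValiantsHypothesis.Theses.LacunarySymmetroid.StampLine

open Summit.ValiantsHypothesis.ValiantsHypothesis.Theorems.MatrixDescartes.Negative (PosRootLawAt)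
open Summit.ValiantsHypothesis.ValiantsHypothesis.Theorems.LacunarySymmetroidMatrixDescartes.StubDescartesCeiling
  (support_det_pencil_subset)
open scoped BigOperators Matrix
open Polynomial

/-! ## §0 Defs (verbatim from lines «hyperbolic» / «finite»; workfiles are not importable) -/

/-- The lacunary symmetric pencil as a polynomial matrix. -/
abbrev pencil {m K : ℕ} (d : Fin K → ℕ) (S : Fin K → Matrix (Fin m) (Fin m) ℝ) :
    Matrix (Fin m) (Fin m) ℝ[X] :=
  ∑ l, ((Polynomial.X : ℝ[X]) ^ d l) • (S l).map Polynomial.C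

/-- Full positive-rootedness: `natDegree p` distinct POSITIVE roots («finite» `IsFullPosRooted`). -/
def IsFullPosRooted (p : ℝ[X]) : Prop := (p.roots.filter (0 < ·)).toFinset.card = p.natDegree

/-- «`ν(m,K) ≤ B`»: every full-positive-rooted symmetric `(m,K)` half-pencil determinant has degree `≤ B`. -/
def StampLawAt (m K B : ℕ) : Prop :=
  ∀ (d : Fin K → ℕ) (S : Fin K → Matrix (Fin m) (Fin m) ℝ), (∀ l, (S l).IsSymm) →
    IsFullPosRooted (pencil d S).det → (pencil d S).det.natDegree ≤ B

/-- Full realisability of a given support `d` at size `m` in degree `n`: the typed search target. -/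
def FullyRealisable (m : ℕ) {K : ℕ} (d : Fin K → ℕ) (n : ℕ) : Prop :=
  ∃ S : Fin K → Matrix (Fin m) (Fin m) ℝ, (∀ l, (S l).IsSymm) ∧
    IsFullPosRooted (pencil d S).det ∧ (pencil d S).det.natDegree = n

/-! ## §1 `ν ≤ ζ`: a full-positive-rooted half-pencil is a census entry (PROVED) -/

/-- **`ν(m,K) ≤ ζ(m,K)`.**  A full-positive-rooted symmetric half-pencil of degree `n` refutes the positive-root row
`n − 1` (tree `Negative.PosRootLawAt`). [folklore] -/
theorem not_posRootLawAt_of_fullPos {m K B : ℕ} (d : Fin K → ℕ) (S : Fin K → Matrix (Fin m) (Fin m) ℝ)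
    (hS : ∀ l, (S l).IsSymm)
    (hfull : IsFullPosRooted (Matrix.det (∑ l, ((Polynomial.X : ℝ[X]) ^ d l) • (S l).map Polynomial.C)))
    (hB : B < (Matrix.det (∑ l, ((Polynomial.X : ℝ[X]) ^ d l) • (S l).map Polynomial.C)).natDegree) :
    ¬ PosRootLawAt m K B := fun h => by
  have h1 : ((Matrix.det (∑ l, ((Polynomial.X : ℝ[X]) ^ d l) • (S l).map Polynomial.C)).roots.toFinset.filter
      (fun t => 0 < t)).card ≤ B := h d S hS
  unfold IsFullPosRooted at hfull
  rw [Multiset.toFinset_filter] at hfull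
  omega

/-- The typed target refutes the row below its degree. [folklore] -/
theorem not_posRootLawAt_of_fullyRealisable {m K n B : ℕ} {d : Fin K → ℕ} (h : FullyRealisable m d n)
    (hB : B < n) : ¬ PosRootLawAt m K B := by
  obtain ⟨S, hS, hfull, hdeg⟩ := h
  have hdeg' : (Matrix.det (∑ l, ((Polynomial.X : ℝ[X]) ^ d l) • (S l).map Polynomial.C)).natDegree = n := hdeg
  exact not_posRootLawAt_of_fullPos d S hS hfull (by omega)

/-- Conversely a positive-root row caps the stamp row: `ζ(m,K) ≤ B ⇒ ν(m,K) ≤ B`. [folklore] -/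
theorem stampLawAt_of_posRootLawAt {m K B : ℕ} (h : PosRootLawAt m K B) : StampLawAt m K B := by
  intro d S hS hfull
  by_contra hlt
  exact not_posRootLawAt_of_fullPos d S hS hfull (not_le.1 hlt) h

/-! ## §2 Full ⇒ the support is an additive `m`-basis of range `≥ deg` (from «finite» T3; PROVED) -/

/-- Descartes: `natDegree q` distinct positive roots force all coefficients `0 … natDegree q` non-zero. [folklore] -/
theorem coeff_ne_zero_of_fullPos {q : ℝ[X]} (hq : q ≠ 0) (hfull : IsFullPosRooted q) {r : ℕ}
    (hr : r ≤ q.natDegree) : q.coeff r ≠ 0 := by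
  have h1 : q.natDegree ≤ q.roots.countP (0 < ·) := by
    rw [Multiset.countP_eq_card_filter]
    unfold IsFullPosRooted at hfull
    calc q.natDegree = (q.roots.filter (0 < ·)).toFinset.card := hfull.symm
      _ ≤ _ := Multiset.toFinset_card_le _
  have h2 : q.roots.countP (0 < ·) ≤ q.signVariations := Polynomial.roots_countP_pos_le_signVariations q
  have h3 : q.signVariations < q.support.card :=
    Literature.Computability.AlgebraicComplexity.signVariations_lt_card_support hq
  have h4 : q.support ⊆ Finset.range (q.natDegree + 1) := Polynomial.supp_subset_range_natDegree_succ
  have h5 : q.support = Finset.range (q.natDegree + 1) :=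
    Finset.eq_of_subset_of_card_le h4 (by rw [Finset.card_range]; omega)
  rw [← Polynomial.mem_support_iff, h5, Finset.mem_range]
  omega

/-- **Postage-stamp ceiling**: full of degree `n` ⇒ `[0,n] ⊆ m·E`. [folklore] -/
theorem mem_sumset_of_fullPos {m K : ℕ} (d : Fin K → ℕ) (S : Fin K → Matrix (Fin m) (Fin m) ℝ)
    (hq : Matrix.det (∑ l, ((Polynomial.X : ℝ[X]) ^ d l) • (S l).map Polynomial.C) ≠ 0)
    (hfull : IsFullPosRooted (Matrix.det (∑ l, ((Polynomial.X : ℝ[X]) ^ d l) • (S l).map Polynomial.C)))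
    {r : ℕ}
    (hr : r ≤ (Matrix.det (∑ l, ((Polynomial.X : ℝ[X]) ^ d l) • (S l).map Polynomial.C)).natDegree) :
    r ∈ (Finset.univ : Finset (Sym (Fin K) m)).image
      (fun s : Sym (Fin K) m => ((s : Multiset (Fin K)).map d).sum) :=
  support_det_pencil_subset d S (Polynomial.mem_support_iff.2 (coeff_ne_zero_of_fullPos hq hfull hr))

/-! ## §3 The extremal additive 2-bases (classical; ranges certified by `decide`) and the TYPED TARGETS -/

/-- `{0} ∪ A₅`, `A₅ = {1,3,5,7,8}` the unique extremal 2-basis with 5 denominations, `n(2,5) = 16`. -/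
def dA5 : Fin 6 → ℕ := ![0, 1, 3, 5, 7, 8]
/-- `{0} ∪ {1,3,5,7,9,10}`, one of the five extremal 2-bases with 6 denominations, `n(2,6) = 20`. -/
def dA6 : Fin 7 → ℕ := ![0, 1, 3, 5, 7, 9, 10]
/-- `{0} ∪ {1,3,5,7,8,17,18}` — extremal `A₇`, `n(2,7) = 26`. -/
def dA7a : Fin 8 → ℕ := ![0, 1, 3, 5, 7, 8, 17, 18]
/-- `{0} ∪ {1,3,4,9,10,12,13}` — extremal `A₇`, `n(2,7) = 26`. -/
def dA7b : Fin 8 → ℕ := ![0, 1, 3, 4, 9, 10, 12, 13]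
/-- `{0} ∪ {1,2,5,8,11,12,13}` — extremal `A₇`, `n(2,7) = 26`. -/
def dA7c : Fin 8 → ℕ := ![0, 1, 2, 5, 8, 11, 12, 13]
/-- `{0} ∪ {1,3,5,7,9,10,21,22}` — extremal `A₈`, `n(2,8) = 32`. -/
def dA8a : Fin 9 → ℕ := ![0, 1, 3, 5, 7, 9, 10, 21, 22]
/-- `{0} ∪ {1,2,5,8,11,14,15,16}` — extremal `A₈`, `n(2,8) = 32`. -/
def dA8b : Fin 9 → ℕ := ![0, 1, 2, 5, 8, 11, 14, 15, 16]

/-- Range certificates: `[0,n] ⊆ 2·({0} ∪ A)` (so a FULL degree-`n` `2×2` half-pencil on the support is NOT excluded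
by the postage-stamp ceiling — and `n + 1 ∉ 2A`, so degree `n` is the most the support allows). -/
theorem range_dA5 : (∀ r ≤ 16, ∃ i j : Fin 6, dA5 i + dA5 j = r) ∧ ¬ ∃ i j : Fin 6, dA5 i + dA5 j = 17 := by
  unfold dA5; decide
theorem range_dA6 : (∀ r ≤ 20, ∃ i j : Fin 7, dA6 i + dA6 j = r) ∧ ¬ ∃ i j : Fin 7, dA6 i + dA6 j = 21 := by
  unfold dA6; decide
theorem range_dA7a : (∀ r ≤ 26, ∃ i j : Fin 8, dA7a i + dA7a j = r) ∧ ¬ ∃ i j : Fin 8, dA7a i + dA7a j = 27 := by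
  unfold dA7a; decide
theorem range_dA7b : (∀ r ≤ 26, ∃ i j : Fin 8, dA7b i + dA7b j = r) ∧ ¬ ∃ i j : Fin 8, dA7b i + dA7b j = 27 := by
  unfold dA7b; decide
theorem range_dA7c : (∀ r ≤ 26, ∃ i j : Fin 8, dA7c i + dA7c j = r) ∧ ¬ ∃ i j : Fin 8, dA7c i + dA7c j = 27 := by
  unfold dA7c; decide
theorem range_dA8a : (∀ r ≤ 32, ∃ i j : Fin 9, dA8a i + dA8a j = r) ∧ ¬ ∃ i j : Fin 9, dA8a i + dA8a j = 33 := by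
  unfold dA8a; decide
theorem range_dA8b : (∀ r ≤ 32, ∃ i j : Fin 9, dA8b i + dA8b j = r) ∧ ¬ ∃ i j : Fin 9, dA8b i + dA8b j = 33 := by
  unfold dA8b; decide

/-- **G6** — `ν(2,6) = 16 = n(2,5)`?  (never searched; engine-5's full records at `(2,6)` have degree 14 on
non-extremal supports).  Decides `η(2,6) = 32` of line «finite». -/
theorem stub_G6 : FullyRealisable 2 dA5 16 := by
  sorry

/-- **G7** — `ν(2,7) = 20 = n(2,6)`? (any of the five extremal bases; this one typed). -/
theorem stub_G7 : FullyRealisable 2 dA6 20 := by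
  sorry

/-- **G8 — THE DIVERGENCE CELL**: a full degree-26 `2×2` half-pencil on one of the three extremal `A₇`. -/
theorem stub_G8 : FullyRealisable 2 dA7a 26 ∨ FullyRealisable 2 dA7b 26 ∨ FullyRealisable 2 dA7c 26 := by
  sorry

/-- **G9** — full degree-32 on an extremal `A₈` (`+5` over the kernel floor `ζ(2,9) ≥ 27`). -/
theorem stub_G9 : FullyRealisable 2 dA8a 32 ∨ FullyRealisable 2 dA8b 32 := by
  sorry

/-! ## §4 DIVERGENCE bookkeeping (PROVED): stamp-sharpness at `(2,8)` kills «eleven-thirds»; «eleven-thirds» kills realisability -/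

/-- **G8 ⇒ «eleven-thirds» is false at `K = 8`** (`⌊11·7/3⌋ = 25`): `ζ(2,8) ≥ 26`. [folklore] -/
theorem not_elevenThirds_at_eight
    (h : FullyRealisable 2 dA7a 26 ∨ FullyRealisable 2 dA7b 26 ∨ FullyRealisable 2 dA7c 26) :
    ¬ PosRootLawAt 2 8 25 := by
  rcases h with h | h | h <;> exact not_posRootLawAt_of_fullyRealisable h (by norm_num)

/-- **G9 ⇒ «eleven-thirds» is false at `K = 9`** (`⌊88/3⌋ = 29`) — and the slope law `4(K−1) = 32` is ATTAINED,
not refuted. [folklore] -/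
theorem not_elevenThirds_at_nine (h : FullyRealisable 2 dA8a 32 ∨ FullyRealisable 2 dA8b 32) :
    ¬ PosRootLawAt 2 9 29 ∧ ¬ PosRootLawAt 2 9 31 := by
  rcases h with h | h <;>
    exact ⟨not_posRootLawAt_of_fullyRealisable h (by norm_num), not_posRootLawAt_of_fullyRealisable h (by norm_num)⟩

/-- **«Eleven-thirds at `K = 8`» ⇒ the three extremal `A₇` are NOT fully realisable by symmetric `2×2` half-pencils**
— the first located NON-REALISABILITY cell, if the linear law holds. [folklore] -/
theorem elevenThirds_blocks_A7 (h : PosRootLawAt 2 8 25) :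
    ¬ FullyRealisable 2 dA7a 26 ∧ ¬ FullyRealisable 2 dA7b 26 ∧ ¬ FullyRealisable 2 dA7c 26 :=
  ⟨fun h' => not_elevenThirds_at_eight (Or.inl h') h,
   fun h' => not_elevenThirds_at_eight (Or.inr (Or.inl h')) h,
   fun h' => not_elevenThirds_at_eight (Or.inr (Or.inr h')) h⟩

/-- More generally any row `ζ(2,8) ≤ 25` caps the stamp row: `ν(2,8) ≤ 25 < 26 = n(2,7)`. [folklore] -/
theorem stampLaw_two_eight_of_elevenThirds (h : PosRootLawAt 2 8 25) : StampLawAt 2 8 25 :=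
  stampLawAt_of_posRootLawAt h

/-- What the tree already knows at the divergence cells (kernel floors, by name): `ζ(2,8) ≥ 21`, `ζ(2,9) ≥ 27`,
`ζ(2,10) ≥ 30` — all BELOW the stamp predictions `26, 32, 40`. -/
theorem kernel_floors_below_stamp :
    ¬ PosRootLawAt 2 8 20 ∧ ¬ PosRootLawAt 2 9 26 ∧ ¬ PosRootLawAt 2 10 29 :=
  ⟨Summit.ValiantsHypothesis.ValiantsHypothesis.Theorems.LacunarySymmetroidMatrixDescartes.Census.M2K8G21.not_posRootLawAt,
   Summit.ValiantsHypothesis.ValiantsHypothesis.Theorems.LacunarySymmetroidMatrixDescartes.Census.M2K9T27.not_posRootLawAt,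
   Summit.ValiantsHypothesis.ValiantsHypothesis.Theorems.LacunarySymmetroidMatrixDescartes.Census.M2K10I30.not_posRootLawAt⟩

/-! ## §5 The Lorentz dictionary for `m = 2` (crit-1's model, typed): `4·det = (a+c)² − (a−c)² − 4b²` -/

/-- **`m = 2` is a light-cone crossing problem.**  For a symmetric `2×2` matrix over any commutative ring,
`4·det = T² − X² − Y²` with `T = a + c`, `X = a − c`, `Y = 2b`; for the pencil, `T, X, Y` are `K`-nomials on the SAME
support `E`, so `ζ(2,K)` = the maximal number of positive parameters at which a `K`-monomial curve in `ℝ^{1,2}` meets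
the light cone, and FULL realisability of an extremal basis = `n(2,K−1)` transversal crossings with every coefficient of
`T² − X² − Y²` (support `2E ⊇ [0,n]`) non-zero and alternating.  A format law linear in `K` needs a crossing bound
for rank-3 quadratic forms on the Descartes system `{u^e}` beating the Descartes count `|2E| − 1`; none is known
(the parameter count `3K − 4` — the «dimension law» — is refuted in tree at `(2,4)`: `not_dimensionLaw_two_four`). -/
theorem four_mul_det_fin_two_symm {R : Type*} [CommRing R] (A : Matrix (Fin 2) (Fin 2) R) (hA : A.IsSymm) :
    4 * A.det = (A 0 0 + A 1 1) ^ 2 - (A 0 0 - A 1 1) ^ 2 - (2 * A 0 1) ^ 2 := by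
  have h10 : A 1 0 = A 0 1 := by
    have := congrFun (congrFun hA 0) 1
    simpa [Matrix.transpose_apply] using this
  rw [Matrix.det_fin_two, h10]
  ring

end Summit.ValiantsHypothesis.ValiantsHypothesis.Theses.LacunarySymmetroid.StampLine

end
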